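/-
Copyright (c) 2026 the pub-hodgecm-mathlib formalisation cell (harness21).  Prover seat hodgecm-mathlib-K2E3-p17 (g6), Track B «K2-LIT» ∕ h413
(`stmt-HodgeConjecture-24833`), line `K2_E3_EllipticInputs`, unit U12 §L, Richardson road for (LBGL-ge3) at `N = 3` (road owner K2E3-p11),
brick (F-J) = (S-B♭)_Lie, FILE F1 «THE ULD CHART `X ↦ (1+X⁺)(1+X⁻)(1+X_d)` OF THE CONGRUENCE SUBGROUP `K_k = 1 + M₃(𝔭^k)` IS HAAR-EXACT».  2026-09-04.
-/
import Summits.HodgeConjecture.HodgeConjecture.Theorems.K2E3GL3RegularDiagonalOrbitChart   -- ★ p857634 (this seat, E2): R1 frame imports, ★ `exists_depth_chart`, boxes; ★ E1 algebra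
import HarnessLib

/-!
# K2_E3 road (h413), §L ∕ Richardson road at `N = 3`, brick (F-J) FILE F1: the ULD chart `M(X) = (1+X⁺)(1+X⁻)(1+X_d)` is a Haar-exact bijection
# `M₃(𝔭^k) → K_k = 1 + M₃(𝔭^k)` for deep `k`

Cell `pub/hodgecm-mathlib` (D-0151), Track B, seat K2E3-p17 (g6), deal (D60) = (F-J) (road owner K2E3-p11; census `K2/K2E3-p17/g6/CENSUS-SBflatLie-N3.K2E3-p17-g6.md` §1 (iv),
brick F).  `--supports stmt-HodgeConjecture-24833 --as helper`; THEOREMS ONLY (no definition ∕ instance ∕ notation ∕ named fact ∕ `sorry`); never imports `Cruxes/…/Lines`.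
COUNT-NEUTRAL.

THE POINT.  The «upper × lower × diagonal» multiplication map `M(X) = (1 + X⁺)(1 + X⁻)(1 + X_d)` on `M₃(K)` is a polynomial map with strict derivative THE IDENTITY at `0`
(`X⁺·1·1 + 1·X⁻·1 + 1·1·X_d = X`).  Hence, over a non-archimedean local field `F`, ★ `exists_depth_chart` (Schikhof §27, the road «HC-D»'s Newton engine) gives a depth `k₀`
such that for all `k ≥ k₀`: `M` is injective on `Λ_k = M₃(𝔭^k)`, `M(Λ_k) = 1 + Λ_k = K_k` (the principal congruence subgroup, as a subset of `M₃(F)`), and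
`∫⁻_{Λ_k} G(M X) dμ𝔤 = ∫⁻_{K_k} G dμ𝔤` for every measurable `G ≥ 0` and every additive Haar measure `μ𝔤` — the Iwahori∕ULD factorisation of `K_k` read as an EXACT change
of variables, with no Jacobian.  FILE F2 (`K2E3GL3DiagonalLevelProductMeasure`) integrates this against the right-`A(𝒪)`-invariant test functions of the (F-J) pullback.
* §1 algebra (`M 0 = 1`, the entrywise derivative identity); §2 `hasStrictFDerivAt_uldChart` over a complete ultrametric normed field (ONE inline NormedRing frame, ★ E1 method);
  §3 **`exists_depth_uldChart`** over the local field (R1 frame inside; Borel∕Haar instances of the normed frame passed explicitly, ★ E2∕HC-D pattern).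
[BernsteinZelevinsky1976, §3 (Iwahori factorisation)] [Schikhof1984, §27 Lemma 27.4–Thm. 27.5] [HarishChandra1970, Part V §4 Lemma 22]
HONEST LABEL: HC_CM is proved only modulo the 7 printed citations (2 remaining named inputs: hLiu418 = stmt-HodgeConjecture-24832, h413 = stmt-HodgeConjecture-24833)
until rung 0 closes; count-neutral helper ((LBGL-ge3)∕(LBGL-3J) NOT ★ here).

## References
* [BernsteinZelevinsky1976] I. N. Bernstein, A. V. Zelevinsky, *Representations of the group GL(n,F)*, Russian Math. Surveys 31:3 (1976), §3.
* [Schikhof1984] W. H. Schikhof, *Ultrametric Calculus* (1984), §27 Lemma 27.4–Thm. 27.5.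
* [HarishChandra1970] Harish-Chandra (van Dijk), *Harmonic Analysis on Reductive p-adic Groups*, LNM 162 (1970), Part V §4 Lemma 22.
-/

set_option autoImplicit false
set_option linter.dupNamespace false

noncomputable section

open MeasureTheory Measure Filter Topology Set Matrix
open scoped MatrixGroups NNReal ENNReal Pointwise
open Literature.NumberTheory.Automorphic Literature.NumberTheory.Automorphic.LocalFieldHaar
open Literature.NumberTheory.GaloisRepresentations Literature.NumberTheory.GaloisRepresentations.IsNonarchimedeanLocalField
open Summit.HodgeConjecture.HodgeConjecture.Cruxes.H413.F0P3cStCharTSStrictDerivNewton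
open Summit.HodgeConjecture.HodgeConjecture.Cruxes.H413.K2E3GLnMaximalParabolicDescent
open Summit.HodgeConjecture.HodgeConjecture.Cruxes.H413.K2E3GL3OrbitChartDeriv

namespace Summit.HodgeConjecture.HodgeConjecture.Cruxes.H413.K2E3GL3ULDChart

/-! ## §1  Algebra -/

section Algebra

variable {R : Type*} [CommRing R]

/-- `M(0) = 1`. [folklore] -/
theorem uldChart_zero :
    (fun X : Matrix (Fin 3) (Fin 3) R =>
        (1 + !![0, X 0 1, X 0 2; 0, 0, X 1 2; 0, 0, 0]) * (1 + !![0, 0, 0; X 1 0, 0, 0; X 2 0, X 2 1, 0]) * (1 + Matrix.diagonal (fun i => X i i))) 0 = 1 := by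
  have hU : (!![0, (0 : Matrix (Fin 3) (Fin 3) R) 0 1, (0 : Matrix (Fin 3) (Fin 3) R) 0 2; 0, 0, (0 : Matrix (Fin 3) (Fin 3) R) 1 2; 0, 0, 0] :
      Matrix (Fin 3) (Fin 3) R) = 0 := by
    ext i j; fin_cases i <;> fin_cases j <;> rfl
  have hL : (!![0, 0, 0; (0 : Matrix (Fin 3) (Fin 3) R) 1 0, 0, 0; (0 : Matrix (Fin 3) (Fin 3) R) 2 0, (0 : Matrix (Fin 3) (Fin 3) R) 2 1, 0] :
      Matrix (Fin 3) (Fin 3) R) = 0 := by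
    ext i j; fin_cases i <;> fin_cases j <;> rfl
  have hD : Matrix.diagonal (fun i => (0 : Matrix (Fin 3) (Fin 3) R) i i) = 0 := Matrix.diagonal_zero
  simp only [hU, hL, hD, add_zero, Matrix.mul_one]

/-- The entrywise value of the product-rule derivative of `M` at `0`: `(X_d + (X⁻ + X⁺))_{ij} = X_{ij}`. [folklore] -/
theorem uld_derivative_entry_formula (v : Matrix (Fin 3) (Fin 3) R) (i j : Fin 3) :
    (Matrix.diagonal (fun i => v i i) + ((!![0, 0, 0; v 1 0, 0, 0; v 2 0, v 2 1, 0] : Matrix (Fin 3) (Fin 3) R) + !![0, v 0 1, v 0 2; 0, 0, v 1 2; 0, 0, 0])) i j =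
      v i j := by
  have hv : Matrix.diagonal (fun i => v i i) = !![v 0 0, 0, 0; 0, v 1 1, 0; 0, 0, v 2 2] := by
    ext a b; fin_cases a <;> fin_cases b <;> simp
  rw [hv]
  fin_cases i <;> fin_cases j <;> simp

end Algebra

/-! ## §2  The strict derivative of `M` at `0` is the identity (complete ultrametric normed field, elementwise sup norm) -/

section Normed

open scoped Matrix.Norms.Elementwise

variable {K : Type*} [NontriviallyNormedField K] [CompleteSpace K] [IsUltrametricDist K]

/-- **`HasStrictFDerivAt M (id) 0`** for `M(X) = (1+X⁺)(1+X⁻)(1+X_d)` — delivered as a continuous linear EQUIVALENCE `e` with `e X = X` (ONE inline NormedRing frame, ★ E1 method).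
[cite: Schikhof1984, §27] [cite: BernsteinZelevinsky1976, §3] -/
theorem hasStrictFDerivAt_uldChart :
    ∃ e : Matrix (Fin 3) (Fin 3) K ≃L[K] Matrix (Fin 3) (Fin 3) K, (∀ X, e X = X) ∧
      HasStrictFDerivAt (fun X : Matrix (Fin 3) (Fin 3) K =>
        (1 + !![0, X 0 1, X 0 2; 0, 0, X 1 2; 0, 0, 0]) * (1 + !![0, 0, 0; X 1 0, 0, 0; X 2 0, X 2 1, 0]) * (1 + Matrix.diagonal (fun i => X i i)))
        (e : Matrix (Fin 3) (Fin 3) K →L[K] Matrix (Fin 3) (Fin 3) K) 0 := by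
  letI : NormedRing (Matrix (Fin 3) (Fin 3) K) :=
    { Matrix.normedAddCommGroup, (inferInstance : Ring (Matrix (Fin 3) (Fin 3) K)) with
      norm_mul_le := Literature.Analysis.Matrix.norm_mul_le_of_isUltrametricDist }
  letI : NormedAlgebra K (Matrix (Fin 3) (Fin 3) K) := { (inferInstance : Algebra K (Matrix (Fin 3) (Fin 3) K)) with norm_smul_le := norm_smul_le }
  haveI : CompleteSpace (Matrix (Fin 3) (Fin 3) K) := inferInstanceAs (CompleteSpace (Fin 3 → Fin 3 → K))
  suffices key : ∃ e : Matrix (Fin 3) (Fin 3) K ≃L[K] Matrix (Fin 3) (Fin 3) K, (∀ X, e X = X) ∧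
      HasStrictFDerivAt (fun X : Matrix (Fin 3) (Fin 3) K =>
        (1 + !![0, X 0 1, X 0 2; 0, 0, X 1 2; 0, 0, 0]) * (1 + !![0, 0, 0; X 1 0, 0, 0; X 2 0, X 2 1, 0]) * (1 + Matrix.diagonal (fun i => X i i)))
        (e : Matrix (Fin 3) (Fin 3) K →L[K] Matrix (Fin 3) (Fin 3) K) 0 by exact key
  set e : Matrix (Fin 3) (Fin 3) K ≃L[K] Matrix (Fin 3) (Fin 3) K := ContinuousLinearEquiv.refl K (Matrix (Fin 3) (Fin 3) K) with he_def
  refine ⟨e, fun X => rfl, ?_⟩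
  let Lu : Matrix (Fin 3) (Fin 3) K →ₗ[K] Matrix (Fin 3) (Fin 3) K :=
    { toFun := fun X => !![0, X 0 1, X 0 2; 0, 0, X 1 2; 0, 0, 0]
      map_add' := fun X Y => by ext i j; fin_cases i <;> fin_cases j <;> simp
      map_smul' := fun a X => by ext i j; fin_cases i <;> fin_cases j <;> simp }
  let Ll : Matrix (Fin 3) (Fin 3) K →ₗ[K] Matrix (Fin 3) (Fin 3) K :=
    { toFun := fun X => !![0, 0, 0; X 1 0, 0, 0; X 2 0, X 2 1, 0]
      map_add' := fun X Y => by ext i j; fin_cases i <;> fin_cases j <;> simp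
      map_smul' := fun a X => by ext i j; fin_cases i <;> fin_cases j <;> simp }
  let Ld : Matrix (Fin 3) (Fin 3) K →ₗ[K] Matrix (Fin 3) (Fin 3) K :=
    { toFun := fun X => Matrix.diagonal fun i => X i i
      map_add' := fun X Y => (Matrix.diagonal_add (fun i => X i i) fun i => Y i i).symm
      map_smul' := fun a X => by ext i j; simp [Matrix.diagonal, Matrix.smul_apply] }
  set Pu : Matrix (Fin 3) (Fin 3) K →L[K] Matrix (Fin 3) (Fin 3) K := LinearMap.toContinuousLinearMap Lu with hPu_def
  set Pl : Matrix (Fin 3) (Fin 3) K →L[K] Matrix (Fin 3) (Fin 3) K := LinearMap.toContinuousLinearMap Ll with hPl_def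
  set Pd : Matrix (Fin 3) (Fin 3) K →L[K] Matrix (Fin 3) (Fin 3) K := LinearMap.toContinuousLinearMap Ld with hPd_def
  have hPu : ∀ X, Pu X = !![0, X 0 1, X 0 2; 0, 0, X 1 2; 0, 0, 0] := fun X => rfl
  have hPl : ∀ X, Pl X = !![0, 0, 0; X 1 0, 0, 0; X 2 0, X 2 1, 0] := fun X => rfl
  have hPd : ∀ X, Pd X = Matrix.diagonal fun i => X i i := fun X => rfl
  have hA : HasStrictFDerivAt (fun X : Matrix (Fin 3) (Fin 3) K => (1 : Matrix (Fin 3) (Fin 3) K) + Pu X) Pu 0 := Pu.hasStrictFDerivAt.const_add 1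
  have hB : HasStrictFDerivAt (fun X : Matrix (Fin 3) (Fin 3) K => (1 : Matrix (Fin 3) (Fin 3) K) + Pl X) Pl 0 := Pl.hasStrictFDerivAt.const_add 1
  have hC : HasStrictFDerivAt (fun X : Matrix (Fin 3) (Fin 3) K => (1 : Matrix (Fin 3) (Fin 3) K) + Pd X) Pd 0 := Pd.hasStrictFDerivAt.const_add 1
  have h₂ := hA.mul' hB
  have h₃ := h₂.mul' hC
  have hfun : (fun X : Matrix (Fin 3) (Fin 3) K =>
        (1 + !![0, X 0 1, X 0 2; 0, 0, X 1 2; 0, 0, 0]) * (1 + !![0, 0, 0; X 1 0, 0, 0; X 2 0, X 2 1, 0]) * (1 + Matrix.diagonal (fun i => X i i))) =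
      ((fun X : Matrix (Fin 3) (Fin 3) K => (1 : Matrix (Fin 3) (Fin 3) K) + Pu X) * fun X => (1 : Matrix (Fin 3) (Fin 3) K) + Pl X) *
        fun X => (1 : Matrix (Fin 3) (Fin 3) K) + Pd X := by
    funext X
    simp only [Pi.mul_apply, hPu, hPl, hPd]
  rw [hfun]
  refine h₃.congr_fderiv (ContinuousLinearMap.ext fun v => ?_)
  have h0u : Pu 0 = 0 := map_zero _
  have h0l : Pl 0 = 0 := map_zero _
  have h0d : Pd 0 = 0 := map_zero _
  ext i j
  simp only [_root_.add_apply, Pi.mul_apply, h0u, h0l, h0d, add_zero, mul_one, MulOpposite.op_one, one_smul]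
  refine Eq.trans ?_ (show v i j = (e : Matrix (Fin 3) (Fin 3) K →L[K] Matrix (Fin 3) (Fin 3) K) v i j from rfl)
  exact uld_derivative_entry_formula v i j

end Normed


/-! ## §3  The local field: the ULD chart is a Haar-exact bijection `M₃(𝔭^k) → K_k = 1 + M₃(𝔭^k)` for deep `k` -/

section LocalField

variable {F : Type*} [Field F] [ValuativeRel F] [TopologicalSpace F] [IsNonarchimedeanLocalField F]
  [MeasurableSpace (Matrix (Fin 3) (Fin 3) F)] [BorelSpace (Matrix (Fin 3) (Fin 3) F)]

/-- **THE ULD CHART IS HAAR-EXACT ON DEEP BOXES.**  For `M(X) = (1+X⁺)(1+X⁻)(1+X_d)` (`hM`) and an additive Haar measure `μ𝔤` on `M₃(F)` there is `k₀` such that for all `k ≥ k₀`: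
(a) `M` is injective on `Λ_k = M₃(𝔭^k)`; (b) `M '' Λ_k = {Y | ∀ i j, (Y − 1) i j ∈ 𝔭^k}` (`= K_k`, the principal congruence subgroup as a subset of `M₃(F)`);
(c) `∫⁻_{Λ_k} G (M X) dμ𝔤 = ∫⁻_{M '' Λ_k} G dμ𝔤` for every measurable `G ≥ 0` (★ `exists_depth_chart` for the strict derivative `id`, whose Haar character is `1`).
[cite: Schikhof1984, §27 Lemma 27.4–Thm. 27.5] [cite: BernsteinZelevinsky1976, §3] -/
theorem exists_depth_uldChart (μ𝔤 : Measure (Matrix (Fin 3) (Fin 3) F)) [μ𝔤.IsAddHaarMeasure]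
    (M : Matrix (Fin 3) (Fin 3) F → Matrix (Fin 3) (Fin 3) F)
    (hM : M = fun X : Matrix (Fin 3) (Fin 3) F =>
        (1 + !![0, X 0 1, X 0 2; 0, 0, X 1 2; 0, 0, 0]) * (1 + !![0, 0, 0; X 1 0, 0, 0; X 2 0, X 2 1, 0]) * (1 + Matrix.diagonal (fun i => X i i))) :
    ∃ k₀ : ℕ, ∀ k : ℕ, k₀ ≤ k →
      Set.InjOn M {X : Matrix (Fin 3) (Fin 3) F | ∀ i j, X i j ∈ primePowBall F k} ∧
      M '' {X : Matrix (Fin 3) (Fin 3) F | ∀ i j, X i j ∈ primePowBall F k} = {Y : Matrix (Fin 3) (Fin 3) F | ∀ i j, (Y - 1) i j ∈ primePowBall F k} ∧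
      (∀ G : Matrix (Fin 3) (Fin 3) F → ℝ≥0∞, Measurable G →
        ∫⁻ X in {X : Matrix (Fin 3) (Fin 3) F | ∀ i j, X i j ∈ primePowBall F k}, G (M X) ∂μ𝔤 =
          ∫⁻ Y in {Y : Matrix (Fin 3) (Fin 3) F | ∀ i j, (Y - 1) i j ∈ primePowBall F k}, G Y ∂μ𝔤) := by
  classical
  -- ===== R1 frame, inside the proof only =====
  letI : NontriviallyNormedField F := IsNonarchimedeanLocalField.nontriviallyNormedField F
  haveI : CompleteSpace F := IsNonarchimedeanLocalField.completeSpace_nontriviallyNormedField F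
  haveI : IsUltrametricDist F := IsNonarchimedeanLocalField.isUltrametricDist_nontriviallyNormedField F
  haveI : ProperSpace F := ProperSpace.of_nontriviallyNormedField_of_weaklyLocallyCompactSpace F
  haveI : T2Space F := (isLocalField F).toT2Space
  haveI : SecondCountableTopology F := secondCountableTopology_localField F
  haveI : IsTopologicalRing F := inferInstance
  letI : NormedAddCommGroup (Matrix (Fin 3) (Fin 3) F) := Matrix.normedAddCommGroup
  letI : NormedSpace F (Matrix (Fin 3) (Fin 3) F) := Matrix.normedSpace
  haveI : IsUltrametricDist (Matrix (Fin 3) (Fin 3) F) := inferInstanceAs (IsUltrametricDist (Fin 3 → Fin 3 → F))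
  haveI : ProperSpace (Matrix (Fin 3) (Fin 3) F) := inferInstanceAs (ProperSpace (Fin 3 → Fin 3 → F))
  haveI : LocallyCompactSpace (Matrix (Fin 3) (Fin 3) F) := locallyCompactSpace_matrix (F := F) (m := Fin 3) (n := Fin 3)
  haveI : SecondCountableTopology (Matrix (Fin 3) (Fin 3) F) := secondCountableTopology_matrix (F := F) (m := Fin 3) (n := Fin 3)
  -- ===== strict derivative `id` =====
  obtain ⟨e, he, hderiv⟩ := hasStrictFDerivAt_uldChart (K := F)
  rw [← hM] at hderiv
  -- ===== ball filtration = boxes =====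
  obtain ⟨ϖ, hϖ0, hϖ⟩ := exists_normAbs_eq_inv (F := F)
  have hγ0 : 0 < ‖ϖ‖ := norm_pos_iff.2 hϖ0
  have hγ1 : ‖ϖ‖ < 1 := by
    rw [IsNonarchimedeanLocalField.norm_lt_one_iff, ← normAbs_lt_one_iff, hϖ]
    exact inv_lt_one_of_one_lt₀ (by exact_mod_cast one_lt_residueFieldCard F)
  obtain ⟨Λ, hΛ⟩ := Literature.Analysis.Calculus.exists_addSubgroup_coe_eq_closedBall (V := Matrix (Fin 3) (Fin 3) F) one_pos hγ0
  have hbox : ∀ k : ℕ, (Λ k : Set (Matrix (Fin 3) (Fin 3) F)) = {X : Matrix (Fin 3) (Fin 3) F | ∀ i j, X i j ∈ primePowBall F k} := by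
    intro k
    rw [hΛ k, one_mul]
    ext X
    rw [mem_closedBall_zero_iff, Matrix.norm_le_iff (pow_nonneg hγ0.le k), Set.mem_setOf_eq]
    refine forall_congr' fun i => forall_congr' fun j => ?_
    rw [← norm_pow, IsNonarchimedeanLocalField.norm_le_norm_iff_vle, Valuation.Compatible.vle_iff_le (v := ValuativeRel.valuation F),
      ← normAbs_le_normAbs_iff, map_pow, hϖ, primePowBall, Set.mem_setOf_eq, zpow_natCast]
  -- ===== the depth chart =====
  obtain ⟨k₀, hk⟩ := @exists_depth_chart F _ (Matrix (Fin 3) (Fin 3) F) _ _ _ _ _ ‹BorelSpace (Matrix (Fin 3) (Fin 3) F)›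
    (Matrix (Fin 3) (Fin 3) F) _ _ _ ‹BorelSpace (Matrix (Fin 3) (Fin 3) F)› μ𝔤 ‹μ𝔤.IsAddHaarMeasure›.toIsFiniteMeasureOnCompacts
    ‹μ𝔤.IsAddHaarMeasure›.toIsAddLeftInvariant M 0 e hderiv Λ 1 ‖ϖ‖ hΛ one_pos hγ0 hγ1
  refine ⟨k₀, fun k hkk => ?_⟩
  obtain ⟨hinj, himg, -, hlin⟩ := hk k hkk
  have hM0 : M 0 = 1 := by rw [hM]; exact uldChart_zero
  -- the image `1 + Λ_k` as a set
  have himgset : (1 : Matrix (Fin 3) (Fin 3) F) +ᵥ {X : Matrix (Fin 3) (Fin 3) F | ∀ i j, X i j ∈ primePowBall F k} =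
      {Y : Matrix (Fin 3) (Fin 3) F | ∀ i j, (Y - 1) i j ∈ primePowBall F k} := by
    ext Y
    rw [← Set.image_vadd, Set.mem_image]
    constructor
    · rintro ⟨X, hX, rfl⟩
      simpa only [Set.mem_setOf_eq, vadd_eq_add, add_sub_cancel_left] using hX
    · intro hY
      exact ⟨Y - 1, hY, by rw [vadd_eq_add, add_sub_cancel]⟩
  have key : ∀ f : Matrix (Fin 3) (Fin 3) F → Matrix (Fin 3) (Fin 3) F, (∀ X, f X = X) →
      M '' {X : Matrix (Fin 3) (Fin 3) F | ∀ i j, X i j ∈ primePowBall F k} = (1 : Matrix (Fin 3) (Fin 3) F) +ᵥ f '' {X : Matrix (Fin 3) (Fin 3) F | ∀ i j, X i j ∈ primePowBall F k} →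
      M '' {X : Matrix (Fin 3) (Fin 3) F | ∀ i j, X i j ∈ primePowBall F k} = {Y : Matrix (Fin 3) (Fin 3) F | ∀ i j, (Y - 1) i j ∈ primePowBall F k} := by
    intro f hf hMf
    rw [hMf, show f = id from funext hf, Set.image_id, himgset]
  have himg' : M '' {X : Matrix (Fin 3) (Fin 3) F | ∀ i j, X i j ∈ primePowBall F k} = {Y : Matrix (Fin 3) (Fin 3) F | ∀ i j, (Y - 1) i j ∈ primePowBall F k} := by
    have h := himg k le_rfl 0 (Λ k).zero_mem
    rw [add_zero, zero_vadd, hM0, hbox k] at h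
    exact key _ (fun X => he X) h
  refine ⟨?_, himg', fun G hG => ?_⟩
  · have h1 := hinj
    rwa [zero_vadd, hbox k] at h1
  · have h1 : ∫⁻ v in {X : Matrix (Fin 3) (Fin 3) F | ∀ i j, X i j ∈ primePowBall F k}, G (M v) ∂μ𝔤 =
        ∫⁻ v in {X : Matrix (Fin 3) (Fin 3) F | ∀ i j, X i j ∈ primePowBall F k}, G (1 + e v) ∂μ𝔤 := by
      have h0 := hlin G hG
      simp only [zero_add, hM0, hbox k] at h0
      exact h0
    rw [h1]
    have hboxm : MeasurableSet {X : Matrix (Fin 3) (Fin 3) F | ∀ i j, X i j ∈ primePowBall F k} :=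
      (Literature.MeasureTheory.Group.isOpen_setOf_forall_mem_primePowBall (F := F) (n := Fin 3) k).measurableSet
    have hKm : MeasurableSet {Y : Matrix (Fin 3) (Fin 3) F | ∀ i j, (Y - 1) i j ∈ primePowBall F k} := by
      rw [← himgset]; exact hboxm.const_vadd _
    -- translation by `1`
    rw [← lintegral_indicator hboxm, ← lintegral_indicator hKm, ← himgset,
      ← lintegral_add_left_eq_self (μ := μ𝔤)
        (((1 : Matrix (Fin 3) (Fin 3) F) +ᵥ {X : Matrix (Fin 3) (Fin 3) F | ∀ i j, X i j ∈ primePowBall F k}).indicator G) (1 : Matrix (Fin 3) (Fin 3) F)]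
    refine lintegral_congr fun v => ?_
    by_cases hv : v ∈ {X : Matrix (Fin 3) (Fin 3) F | ∀ i j, X i j ∈ primePowBall F k}
    · rw [Set.indicator_of_mem hv, Set.indicator_of_mem]
      · show G (1 + e v) = G (1 + v)
        rw [he v]
      · exact Set.vadd_mem_vadd_set_iff.2 hv
    · rw [Set.indicator_of_notMem hv, Set.indicator_of_notMem]
      exact fun h' => hv (Set.vadd_mem_vadd_set_iff.1 h')

end LocalField

end Summit.HodgeConjecture.HodgeConjecture.Cruxes.H413.K2E3GL3ULDChart

end
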